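import Summits.BirchSwinnertonDyer.BirchSwinnertonDyer.Theorems.KolyvaginDepthDoorKolyvaginDepthSupplyLeafReciprocityOfPoitouTate
import HarnessLib

/-!
# Route `KolyvaginDepthDoor`, crux `KolyvaginDepthSupply` (stmt-BirchSwinnertonDyer-21765) —
# LEAF 5 OF THE hF-FREE DOOR AT LEVEL `p`, PROVED: McCallum 1991 Prop. 2.2 with Lemma 5.3 at a
# finite set of Kolyvagin places (the door's `hdual`), from the tree's Poitou–Tate THEOREM

Helper file (`--supports stmt-BirchSwinnertonDyer-21765 --as helper`); it closes nothing and BSD is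
not proved by it.

The hF-free door of this route (`…KolyvaginDepthSupplyDoorOfDatum`, via
`exists_hypothesesDepth_of_classes`) consumes, as hypothesis `hdual` (there fed by the named leaf
`McCallum1991.prop22_reciprocity_eigen_finset` at `M = 1`, "Size M; no `_holds`"), McCallum's
reciprocity law Prop. 2.2 *"`∑_v inv_v(c_v ∪ c'_v) = 0`"* USED as in the proof of his Prop. 5.2
(p. 306: *"the only possible non-zero terms in the sum (13) are at `v = λ₀, λ'`"*) and read at `λ`
through Lemma 5.3: for a finite set `T` of Kolyvagin primes, `ℓ ∈ T`, an `e`-eigenclass `x` Selmer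
off the places of `T` and at infinity, and `s ∈ Sel_p(E/K)^e` vanishing at the places of
`T ∖ {ℓ}`: if `s_λ ≠ 0` then `x_λ ∈ δ(E(K_λ))`.

THIS FILE PROVES IT at level `p`, composing: PART 1 (`…LeafReciprocityOfPoitouTate`:
`kolyvaginReciprocityFinset_of_poitouTate_of_hasGoodReductionAt`, x11b3's (R)_M from (PT) without the
idle rank-one binders), the Gross-cluster theorem `lemma_5_3_descent_of_reciprocity` (file
`HeegnerPointsKolyvaginPrimaryProp82Proofs`: Lemma 5.3 with Prop. 2.2 — everything but the
reciprocity law, PROVED) at `M = 1`, `a = 0`, the bridge `JET.ZhangGross.isKolyvaginPrime_of_zhang`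
(Zhang ⟹ Gross primes at odd `p` under `ρ̄_{E,p}` onto), and the tree THEOREM
`poitouTate_sum_localTatePairing_eq_zero_holds` (cell `bsd-cn100`, `GaloisCohomology/PoitouTateNumberField`,
every number field `K : Type`) discharging (PT).

* `prop22_reciprocity_eigen_finset_one_of_poitouTate` — the door's `hdual` at level `p ^ 1` (door
  currency: Zhang–Kolyvagin primes for `N = N_E`, any finite place `v ∋ ℓ`) from `hPT`;
* `prop22_reciprocity_eigen_finset_one` — **the same, UNCONDITIONAL** (`K : Type`).

Level `p` only (all doors and rows of the route sit at `c_1(n)`); nothing is asserted about any curve;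
BSD is not proved by it.

References: [McCallumLMS1991] §2 Prop. 2.2 (p. 297), §5 Lemma 5.3 (p. 304), proof of Prop. 5.2
(p. 306); [GrossLMS1991] §8 Prop. 8.2, §9 Prop. 9.6; [MilneADT2006] Ch. I Thm. 4.10 (b), Cor. 2.3;
[WZhang2014] Notations (xii).
-/

set_option linter.dupNamespace false

noncomputable section

open scoped Classical Pointwise

namespace Summit.BirchSwinnertonDyer.BirchSwinnertonDyer.Theorems.KolyvaginDepthDoor

open WeierstrassCurve NumberField IsDedekindDomain Field
open Literature.NumberTheory.EllipticCurves Literature.NumberTheory.EllipticCurves.ModularForms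
open Literature.NumberTheory.GaloisRepresentations Literature.NumberTheory.GaloisCohomology

/-! ## The door's `hdual` at level `p`, from (PT) -/

section Door

-- `K : Type`: the tree's Zhang–Kolyvagin vocabulary is universe `0`.
variable {K : Type} [Field K] [NumberField K] (W : WeierstrassCurve ℚ)

/-- **McCallum 1991 Prop. 2.2 with Lemma 5.3 at a finite set of Kolyvagin places, level `p`, FROM
POITOU–TATE** — the hypothesis `hdual` of `exists_hypothesesDepth_of_classes` (= the body of the
leaf `McCallum1991.prop22_reciprocity_eigen_finset` at `M = 1`, `a = 0`, in the door's currency):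
`E/ℚ` globally minimal with a modular parametrisation of level `N_E`, `K` imaginary quadratic with
non-trivial automorphism `c`, `p` odd with `ρ̄_{E,p}` onto; for a finite set `T` of Zhang–Kolyvagin
primes, `ℓ ∈ T`, `e = ±1`, an `e`-eigenclass `x ∈ H¹(K, E[p^1])` Selmer at the finite places
containing no prime of `T` and at infinity, and `s ∈ Sel^{(p)}(E/K)^e` vanishing in
`H¹(K_v, E[p])` at the places over `T ∖ {ℓ}`: at any `v ∋ ℓ`, `s_v ≠ 0 ⟹ x ∈ δ(E(K_v))`.
Proof: `kolyvaginReciprocityFinset_of_poitouTate_of_hasGoodReductionAt` at `M = 1` with the set of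
places of `T ∖ {ℓ}` (Zhang ⟹ Gross primes by `JET.ZhangGross.isKolyvaginPrime_of_zhang`; `λ` good
as `ℓ ∤ N_E`), then `lemma_5_3_descent_of_reciprocity` at `M = 1`, `a = 0`, contrapositively.
CONDITIONAL on `hPT` only. [cite: McCallumLMS1991, §2 Prop. 2.2, §5 Lemma 5.3, proof of Prop. 5.2 (p. 306)]
[cite: GrossLMS1991, §8 Prop. 8.2] [cite: MilneADT2006, Ch. I Thm. 4.10(b)] -/
theorem prop22_reciprocity_eigen_finset_one_of_poitouTate
    (hPT : poitouTate_sum_localTatePairing_eq_zero K)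
    [W.IsElliptic] [W.IsGloballyMinimal] [NeZero (W.conductorNorm ℤ)]
    (Dt : ModularParametrizationData W (W.conductorNorm ℤ))
    (hK : IsImaginaryQuadratic K) {p : ℕ} [Fact p.Prime] (hp2 : p ≠ 2)
    (hρ : W.HasSurjectiveModNGaloisRep p) {c : K ≃ₐ[ℚ] K} (hc : c ≠ 1)
    (T : Finset ℕ) (hT : ∀ r ∈ T, Zhang2014.IsKolyvaginPrime (W.conductorNorm ℤ) W K p r)
    {ℓ : ℕ} (hℓT : ℓ ∈ T) {e : ℤ} (he : e = 1 ∨ e = -1)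
    (x : galH1Torsion (W.baseChange K) ((p ^ 1 : ℕ) : ℤ))
    (hx : conjAct W c ((p ^ 1 : ℕ) : ℤ) x = e • x)
    (hxfin : ∀ v : HeightOneSpectrum (𝓞 K), (∀ r ∈ T, (r : 𝓞 K) ∉ v.asIdeal) →
      x ∈ selmerLocalKer (W.baseChange K) (v.adicCompletion K) ((p ^ 1 : ℕ) : ℤ))
    (hxinf : ∀ w : InfinitePlace K, x ∈ selmerLocalKer (W.baseChange K) w.Completion ((p ^ 1 : ℕ) : ℤ))
    (s : galH1Torsion (W.baseChange K) ((p ^ 1 : ℕ) : ℤ))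
    (hs : s ∈ selmerGroup (W.baseChange K) ((p ^ 1 : ℕ) : ℤ))
    (hτs : conjAct W c ((p ^ 1 : ℕ) : ℤ) s = e • s)
    (hsT : ∀ r ∈ T, r ≠ ℓ → ∀ v : HeightOneSpectrum (𝓞 K), (r : 𝓞 K) ∈ v.asIdeal →
      s ∈ (W.baseChange K).torsionLocalKer (v.adicCompletion K) ((p ^ 1 : ℕ) : ℤ))
    (v : HeightOneSpectrum (𝓞 K)) (hv : (ℓ : 𝓞 K) ∈ v.asIdeal)
    (hsv : s ∉ (W.baseChange K).torsionLocalKer (v.adicCompletion K) ((p ^ 1 : ℕ) : ℤ)) :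
    x ∈ selmerLocalKer (W.baseChange K) (v.adicCompletion K) ((p ^ 1 : ℕ) : ℤ) := by
  have hp : p.Prime := Fact.out
  by_contra hxv
  -- Zhang ⟹ Gross at every prime of `T`
  have hG : ∀ r ∈ T, IsKolyvaginPrime (W.conductorNorm ℤ) W K p r := fun r hr ↦
    Summit.BirchSwinnertonDyer.Rank1Residual.JET.ZhangGross.isKolyvaginPrime_of_zhang W K hK hp2 hρ
      (hT r hr)
  have hℓG : IsKolyvaginPrime (W.conductorNorm ℤ) W K p ℓ := hG ℓ hℓT
  have hveq : v = hℓG.place := hℓG.mem_iff.mp hv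
  subst hveq
  -- good reduction of `E/K` at `λ`: `ℓ ∤ N_E`
  have hgood : (W.baseChange K).HasGoodReductionAt hℓG.place := by
    haveI : hℓG.place.asIdeal.LiesOver (hℓG.place.under (𝓞 ℚ)).asIdeal := ⟨rfl⟩
    exact hasGoodReductionAt_baseChange_of_hasGoodReductionAt_rat W (hℓG.place.under (𝓞 ℚ))
      hℓG.place (hasGoodReductionAt_of_isNewformOf_of_not_dvd W Dt.isNewformOf hℓG.prime hℓG.2.1 _
        hℓG.natCast_mem_under)
  have hfrob : FrobEqFrobInfty W K (p ^ 1) ℓ := by rw [pow_one]; exact hℓG.2.2.2.2.2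
  -- (R)_1 against `s` vanishing on the places of `T ∖ {ℓ}`
  obtain ⟨A, _, eA, halt, hnd, hR⟩ :=
    kolyvaginReciprocityFinset_of_poitouTate_of_hasGoodReductionAt (W.conductorNorm ℤ) W K hPT hp
      (M := 1) le_rfl hℓG hgood
  let T' : Finset (HeightOneSpectrum (𝓞 K)) :=
    (T.erase ℓ).attach.image fun r ↦ (hG r.1 (Finset.mem_of_mem_erase r.2)).place
  have hsT' : ∀ v' ∈ T', s ∈ (W.baseChange K).torsionLocalKer (v'.adicCompletion K)
      ((p ^ 1 : ℕ) : ℤ) := by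
    intro v' hv'
    obtain ⟨r, -, rfl⟩ := Finset.mem_image.mp hv'
    obtain ⟨hrℓ, hrT⟩ := Finset.mem_erase.mp r.2
    exact hsT r.1 hrT hrℓ _ (hG r.1 hrT).mem_place
  have hxfin' : ∀ v' : HeightOneSpectrum (𝓞 K), v' ∉ T' → (ℓ : 𝓞 K) ∉ v'.asIdeal →
      x ∈ selmerLocalKer (W.baseChange K) (v'.adicCompletion K) ((p ^ 1 : ℕ) : ℤ) := by
    intro v' hv'T hℓv'
    refine hxfin v' fun r hr hrv' ↦ ?_
    by_cases hrℓ : r = ℓ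
    · exact hℓv' (hrℓ ▸ hrv')
    · apply hv'T
      have hv'eq : v' = (hG r hr).place := (hG r hr).mem_iff.mp hrv'
      exact Finset.mem_image.mpr ⟨⟨r, Finset.mem_erase.mpr ⟨hrℓ, hr⟩⟩, Finset.mem_attach _ _,
        hv'eq.symm⟩
  have hRx := hR T' s hs hsT' x hxfin' hxinf
  -- McCallum's Lemma 5.3 with Prop. 2.2 at `M = 1`, `a = 0`
  have hxv' : ((p : ℤ) ^ 0) • x ∉
      selmerLocalKer (W.baseChange K) (hℓG.place.adicCompletion K) ((p ^ 1 : ℕ) : ℤ) := by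
    rwa [pow_zero, one_zsmul]
  have h53 := lemma_5_3_descent_of_reciprocity W hK hp hp2 hc hℓG (M := 1) le_rfl (q := p ^ 1)
    rfl hfrob hgood eA halt hnd he hx hxv' hs hτs hRx
  rw [show 1 - 1 - 0 = 0 from rfl, pow_zero, one_zsmul] at h53
  exact hsv h53

/-- **LEAF 5 AT LEVEL `p`, UNCONDITIONAL**: the door's `hdual` (McCallum Prop. 2.2 with Lemma 5.3
at a finite set of Kolyvagin places, level `p ^ 1`, door currency) with the Poitou–Tate input
DISCHARGED by the tree's theorem `poitouTate_sum_localTatePairing_eq_zero_holds` (cell `bsd-cn100`,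
file `GaloisCohomology/PoitouTateNumberField`; `K : Type`). Binders as in
`prop22_reciprocity_eigen_finset_one_of_poitouTate` minus `hPT`.
[cite: McCallumLMS1991, §2 Prop. 2.2, §5 Lemma 5.3] [cite: MilneADT2006, Ch. I Thm. 4.10(b)] -/
theorem prop22_reciprocity_eigen_finset_one
    [W.IsElliptic] [W.IsGloballyMinimal] [NeZero (W.conductorNorm ℤ)]
    (Dt : ModularParametrizationData W (W.conductorNorm ℤ))
    (hK : IsImaginaryQuadratic K) {p : ℕ} [Fact p.Prime] (hp2 : p ≠ 2)
    (hρ : W.HasSurjectiveModNGaloisRep p) {c : K ≃ₐ[ℚ] K} (hc : c ≠ 1)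
    (T : Finset ℕ) (hT : ∀ r ∈ T, Zhang2014.IsKolyvaginPrime (W.conductorNorm ℤ) W K p r)
    {ℓ : ℕ} (hℓT : ℓ ∈ T) {e : ℤ} (he : e = 1 ∨ e = -1)
    (x : galH1Torsion (W.baseChange K) ((p ^ 1 : ℕ) : ℤ))
    (hx : conjAct W c ((p ^ 1 : ℕ) : ℤ) x = e • x)
    (hxfin : ∀ v : HeightOneSpectrum (𝓞 K), (∀ r ∈ T, (r : 𝓞 K) ∉ v.asIdeal) →
      x ∈ selmerLocalKer (W.baseChange K) (v.adicCompletion K) ((p ^ 1 : ℕ) : ℤ))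
    (hxinf : ∀ w : InfinitePlace K, x ∈ selmerLocalKer (W.baseChange K) w.Completion ((p ^ 1 : ℕ) : ℤ))
    (s : galH1Torsion (W.baseChange K) ((p ^ 1 : ℕ) : ℤ))
    (hs : s ∈ selmerGroup (W.baseChange K) ((p ^ 1 : ℕ) : ℤ))
    (hτs : conjAct W c ((p ^ 1 : ℕ) : ℤ) s = e • s)
    (hsT : ∀ r ∈ T, r ≠ ℓ → ∀ v : HeightOneSpectrum (𝓞 K), (r : 𝓞 K) ∈ v.asIdeal →
      s ∈ (W.baseChange K).torsionLocalKer (v.adicCompletion K) ((p ^ 1 : ℕ) : ℤ))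
    (v : HeightOneSpectrum (𝓞 K)) (hv : (ℓ : 𝓞 K) ∈ v.asIdeal)
    (hsv : s ∉ (W.baseChange K).torsionLocalKer (v.adicCompletion K) ((p ^ 1 : ℕ) : ℤ)) :
    x ∈ selmerLocalKer (W.baseChange K) (v.adicCompletion K) ((p ^ 1 : ℕ) : ℤ) :=
  prop22_reciprocity_eigen_finset_one_of_poitouTate W (poitouTate_sum_localTatePairing_eq_zero_holds K)
    Dt hK hp2 hρ hc T hT hℓT he x hx hxfin hxinf s hs hτs hsT v hv hsv

end Door

end Summit.BirchSwinnertonDyer.BirchSwinnertonDyer.Theorems.KolyvaginDepthDoor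

end
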